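import Summits.QuantumFields.YangMills.Theorems.BalabanUVNodesPortU8LiftRegion

/-!
# PORT PT-B (U8), g3 file 6 — FIELDS UNDER THE CENTRED LIFT: push-forward by zero (`Function.extend` along `liftBondCtr ∕ liftSiteCtr`), sums of fields supported on a lifted
# region, the local lattice operators (`grad ∕ diverg ∕ curl ∕ laplace`) at lifted sites, and the block averages `Q′_{k+1} ∕ Q_{k+1}` (one-stroke ✓B5Eq118) at lifted window
# blocks ∕ window bonds — the analytic-bookkeeping half of the (R4ᴰ-Loc) TRANSPORT lemma

Cell `ym-nodeO-ideate` ∕ `ym-balaban-port`, porter `ymgap-nodeO-port-PTB-1` (gen 3), item **stmt-QuantumFields-27931** `BalabanUVNodes.PortPieceLocalityU8`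
(text ⁷⁗ «v10-Loc» `d796c7a1386a82f1`).  `--supports stmt-QuantumFields-27931` (helper).  [B5] = [Balaban1984PropagatorsI], [B6] = [Balaban1984PropagatorsII], [I] = [Balaban1987RG1].

WHAT THIS FILE PROVES (theorems only; no `def ∕ instance ∕ notation ∕ sorry`; standard axioms):
* §1 `sum_eq_sum_of_support_range` (a sum over the big lattice of a function supported on the range of an injective map is the pulled-back sum), `extend_liftBondCtr_apply ∕ _of_not_mem_range`,
  `extend_liftSiteCtr_apply ∕ _of_not_mem_range`;
* §2 the local operators at lifted sites, given the local commutation of the lift with the unit steps: `grad_liftBondCtr`, `diverg_liftSiteCtr`, `laplace_liftSiteCtr`, `curl_liftPlaq`;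
* §3 ★ `siteAvgIter_liftSiteCtr` (`(Q′_{k+1} f′)(lift y) = (Q′_{k+1} (f′ ∘ lift))(y)` for `y` in a no-reach cube), ★ `bondAvgIter_liftBondCtr` (`(Q_{k+1} A′)(lift c) = (Q_{k+1} (A′ ∘ lift))(c)` for a coarse
  bond with both ends in a no-reach cube) — via the one-stroke formulas ✓`siteAvgIter_eq_blockSum` ∕ ✓`bondAvgIter_eq_blockSum`, ✓`image_liftSiteCtr_iterBlock` and the run commutation.
HONEST FRAMING.  Lattice bookkeeping; nothing of Bałaban asserted∕ported∕discharged; 27931 OPEN · SIGNED v10-Loc · close HOLD (№495); K0⁷ OPEN; NODE O 0∕1; COUNT 8∕28 · K 1∕4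
UNMOVED; finite `𝕋⁴_{L^K}` at fixed ε — NOT continuum ∕ OS ∕ Clay; **the Yang–Mills mass gap (Clay) is NOT proved by any of this.**
-/

noncomputable section

open scoped BigOperators

namespace Summit.QuantumFields.YangMills.Theorems.PortU8

open Literature.MathematicalPhysics.QuantumFieldTheory.Balaban1983to89
open Literature.MathematicalPhysics.QuantumFieldTheory.Balaban1983to89.Node00
open Literature.MathematicalPhysics.QuantumFieldTheory.Balaban1983to89.T4Continuum (T4Family)
open Literature.MathematicalPhysics.QuantumFieldTheory.Balaban1983to89.B5Eq118OneStroke (iterBlockOf iterBlock)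
open Literature.MathematicalPhysics.QuantumFieldTheory.Balaban1983to89.LatticeFieldCalculus
open Summit.QuantumFields.YangMills.Theorems.K0RecordFormatNames

variable (F : T4Family)

/-! ## §1  Sums of fields supported on a lifted region; the push-forward by zero -/

/-- **A sum over the big lattice of a function supported on the range of an injective map is the pulled-back sum.** [folklore] -/
theorem sum_eq_sum_of_support_range {α β M : Type*} [Fintype α] [Fintype β] [DecidableEq β] [AddCommMonoid M] {f : α → β} (hf : Function.Injective f)
    (g' : β → M) (g : α → M) (h1 : ∀ b, g' b ≠ 0 → b ∈ Set.range f) (h2 : ∀ a, g' (f a) = g a) : ∑ b, g' b = ∑ a, g a := by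
  classical
  have hsub : ∑ b ∈ (Finset.univ : Finset α).image f, g' b = ∑ b, g' b := by
    refine Finset.sum_subset (Finset.subset_univ _) fun b _ hb => ?_
    by_contra h
    obtain ⟨a, rfl⟩ := h1 b h
    exact hb (Finset.mem_image_of_mem f (Finset.mem_univ a))
  rw [← hsub, Finset.sum_image fun a _ a' _ h => hf h]
  exact Finset.sum_congr rfl fun a _ => h2 a

/-- The push-forward by zero of a fine bond field, read on a lifted bond. [cite: Balaban1987RG1, (1.21) p.264 (bookkeeping)] -/
theorem extend_liftBondCtr_apply {V : Type*} [Zero V] (K : ℕ) (g : PBond (F.P K) 0 → V) (b : PBond (F.P K) 0) :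
    Function.extend (liftBondCtr F K 0) g 0 (liftBondCtr F K 0 b) = g b :=
  (liftBondCtr_injective F K 0 (Nat.zero_le _)).extend_apply g 0 b

/-- The push-forward by zero of a fine bond field vanishes off the lifted bonds. [cite: Balaban1987RG1, (1.21) p.264 (bookkeeping)] -/
theorem extend_liftBondCtr_of_not_mem_range {V : Type*} [Zero V] (K : ℕ) (g : PBond (F.P K) 0 → V) {b' : PBond (F.P (K + 1)) 0}
    (hb : b' ∉ Set.range (liftBondCtr F K 0)) : Function.extend (liftBondCtr F K 0) g 0 b' = 0 := by
  rw [Function.extend_apply' g (0 : PBond (F.P (K + 1)) 0 → V) b' (by rintro ⟨a, rfl⟩; exact hb ⟨a, rfl⟩)]; rfl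

/-- The push-forward by zero of a fine site field, read on a lifted site. [cite: Balaban1987RG1, (1.21) p.264 (bookkeeping)] -/
theorem extend_liftSiteCtr_apply {V : Type*} [Zero V] (K : ℕ) (g : Site (F.P K) 0 → V) (s : Site (F.P K) 0) :
    Function.extend (liftSiteCtr F K 0) g 0 (liftSiteCtr F K 0 s) = g s :=
  (liftSiteCtr_injective F K 0 (Nat.zero_le _)).extend_apply g 0 s

/-- The push-forward by zero of a fine site field vanishes off the lifted sites. [cite: Balaban1987RG1, (1.21) p.264 (bookkeeping)] -/
theorem extend_liftSiteCtr_of_not_mem_range {V : Type*} [Zero V] (K : ℕ) (g : Site (F.P K) 0 → V) {s' : Site (F.P (K + 1)) 0}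
    (hs : s' ∉ Set.range (liftSiteCtr F K 0)) : Function.extend (liftSiteCtr F K 0) g 0 s' = 0 := by
  rw [Function.extend_apply' g (0 : Site (F.P (K + 1)) 0 → V) s' (by rintro ⟨a, rfl⟩; exact hs ⟨a, rfl⟩)]; rfl

/-! ## §2  The local lattice operators at lifted sites -/

section Local

variable {V : Type*} [AddCommGroup V] [Module ℝ V]

/-- **Gradient at a lifted bond**: if the lift commutes with `+e_{dir}` at `b.src`, `(∂f′)(lift b) = (∂(f′ ∘ lift))(b)`. [cite: Balaban1984PropagatorsI, (1.4) p.18 (bookkeeping)] -/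
theorem grad_liftBondCtr (K : ℕ) (c : ℝ) (f' : SiteField (F.P (K + 1)) 0 V) (b : PBond (F.P K) 0)
    (hb : liftSiteCtr F K 0 (b.src.shift b.dir) = (liftSiteCtr F K 0 b.src).shift b.dir) :
    grad c f' (liftBondCtr F K 0 b) = grad c (fun s => f' (liftSiteCtr F K 0 s)) b := by
  simp only [grad, PBond.tgt]
  show c • (f' ((liftSiteCtr F K 0 b.src).shift b.dir) - f' (liftSiteCtr F K 0 b.src)) = _
  rw [← hb]

/-- **Divergence at a lifted site**: if the lift commutes with every `−e_μ` at `s`, `(∂*A′)(lift s) = (∂*(A′ ∘ lift))(s)`. [cite: Balaban1984PropagatorsI, (1.21) p.21 (bookkeeping)] -/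
theorem diverg_liftSiteCtr (K : ℕ) (c : ℝ) (A' : VecField (F.P (K + 1)) 0 V) (s : Site (F.P K) 0)
    (hs : ∀ μ, liftSiteCtr F K 0 (s.unshift μ) = (liftSiteCtr F K 0 s).unshift μ) :
    diverg c A' (liftSiteCtr F K 0 s) = diverg c (fun b => A' (liftBondCtr F K 0 b)) s := by
  simp only [diverg]
  refine Finset.sum_congr rfl fun μ _ => ?_
  rw [← hs μ]; rfl

/-- **Laplacian at a lifted site**: if the lift commutes with every `±e_μ` at `s`, `(Δf′)(lift s) = (Δ(f′ ∘ lift))(s)`. [cite: Balaban1984PropagatorsI, (1.21) p.21 (bookkeeping)] -/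
theorem laplace_liftSiteCtr (K : ℕ) (c : ℝ) (f' : SiteField (F.P (K + 1)) 0 V) (s : Site (F.P K) 0)
    (hs : ∀ μ, liftSiteCtr F K 0 (s.shift μ) = (liftSiteCtr F K 0 s).shift μ) (hu : ∀ μ, liftSiteCtr F K 0 (s.unshift μ) = (liftSiteCtr F K 0 s).unshift μ) :
    laplace c f' (liftSiteCtr F K 0 s) = laplace c (fun t => f' (liftSiteCtr F K 0 t)) s := by
  simp only [laplace]
  refine Finset.sum_congr rfl fun μ _ => ?_
  rw [← hs μ, ← hu μ]

/-- **Curl at a lifted plaquette**: if the lift commutes with `+e_μ` and `+e_ν` at the base point, `(∂A′)(lift p) = (∂(A′ ∘ lift))(p)`.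
[cite: Balaban1984PropagatorsI, (1.2) p.18 (bookkeeping)] -/
theorem curl_liftPlaq (K : ℕ) (c : ℝ) (A' : VecField (F.P (K + 1)) 0 V) (p : Plaq (F.P K) 0)
    (hμ : liftSiteCtr F K 0 (p.src.shift p.μ) = (liftSiteCtr F K 0 p.src).shift p.μ) (hν : liftSiteCtr F K 0 (p.src.shift p.ν) = (liftSiteCtr F K 0 p.src).shift p.ν) :
    curl c A' ⟨liftSiteCtr F K 0 p.src, p.μ, p.ν, p.hμν⟩ = curl c (fun b => A' (liftBondCtr F K 0 b)) p := by
  simp only [curl]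
  rw [← hμ, ← hν]
  rfl

end Local

/-! ## §3  The block averages `Q′_{k+1}`, `Q_{k+1}` at lifted window blocks ∕ bonds -/

section Averages

variable {V : Type*} [AddCommGroup V] [Module ℝ V]

/-- ★ **`(Q′_{k+1} f′)(lift y) = (Q′_{k+1}(f′ ∘ lift))(y)`** for a coarse site `y` of a no-reach cube (`2(|z₀ i| + R + 1) ≤ N_{k+1}`, `y ∈ recordWindow R z₀`; standing range):
the lift carries `B^{k+1}(y)` bijectively onto `B^{k+1}(lift y)`. [cite: Balaban1984PropagatorsI, (1.20) p.20; Balaban1987RG1, (1.21) p.264] -/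
theorem siteAvgIter_liftSiteCtr {k K R : ℕ} (hk : k + 1 ≤ F.m + K) {z₀ : Fin 4 → ℤ} (hc : ∀ i, 2 * (|z₀ i| + R + 1) ≤ ((F.P K).sitesPerDir (k + 1) : ℤ))
    {y : Site (F.P K) (k + 1)} (hy : y ∈ recordWindow F k K R z₀) (f' : SiteField (F.P (K + 1)) 0 V) :
    siteAvgIter (k + 1) f' (liftSiteCtr F K (k + 1) y) = siteAvgIter (k + 1) (fun s => f' (liftSiteCtr F K 0 s)) y := by
  classical
  have hkK : k + 1 ≤ (F.P K).m + (F.P K).K := by simpa using hk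
  have hkK' : k + 1 ≤ (F.P (K + 1)).m + (F.P (K + 1)).K := by simp only [T4Family.P_m, T4Family.P_K]; omega
  rw [B5Eq118OneStroke.siteAvgIter_eq_blockSum (k + 1) hkK', B5Eq118OneStroke.siteAvgIter_eq_blockSum (k + 1) hkK, ← image_liftSiteCtr_iterBlock F k K R hk z₀ hc hy,
    Finset.sum_image fun a _ a' _ h => liftSiteCtr_injective F K 0 (Nat.zero_le _) h]
  rfl

/-- A fine label whose coordinate runs from block `a` into block `a + 1`, both no-reach, is strictly centred. [folklore] -/
theorem two_mul_abs_lt_of_run {M N N0 : ℤ} (hM : 0 < M) (hN0 : N0 = M * N) {a w : ℤ} (ha : 2 * (|a| + 1) ≤ N) (ha' : 2 * (|a + 1| + 1) ≤ N)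
    (h1 : a * M ≤ w) (h2 : w ≤ (a + 2) * M - 1) : 2 * |w| < N0 := by
  have hw : |w| < M * (|a + 1| + 1) ∨ |w| < M * (|a| + 1) := by
    rcases le_or_gt 0 w with hw0 | hw0
    · left; rw [abs_of_nonneg hw0]
      rcases abs_cases (a + 1) with ⟨h, _⟩ | ⟨h, _⟩ <;> rw [h] <;> nlinarith
    · right; rw [abs_of_neg hw0]
      rcases abs_cases a with ⟨h, _⟩ | ⟨h, _⟩ <;> rw [h] <;> nlinarith
  rcases hw with hw | hw
  · have : M * (2 * (|a + 1| + 1)) ≤ N0 := by rw [hN0]; exact mul_le_mul_of_nonneg_left ha' hM.le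
    linarith
  · have : M * (2 * (|a| + 1)) ≤ N0 := by rw [hN0]; exact mul_le_mul_of_nonneg_left ha hM.le
    linarith

/-- ★ **`(Q_{k+1} A′)(lift c) = (Q_{k+1}(A′ ∘ lift))(c)`** for a coarse bond `c` with BOTH ends in a no-reach cube (`2(|z₀ i| + R + 1) ≤ N_{k+1}`, `c.src, c.tgt ∈ recordWindow R z₀`;
standing range): the lift carries `B^{k+1}(c₋)` onto `B^{k+1}(lift c₋)` and the straight contours of `L^{k+1}` bonds issuing from it onto those issuing from the image.
[cite: Balaban1984PropagatorsI, (1.18) p.20; Balaban1987RG1, (1.21) p.264] -/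
theorem bondAvgIter_liftBondCtr {k K R : ℕ} (hk : k + 1 ≤ F.m + K) {z₀ : Fin 4 → ℤ} (hc : ∀ i, 2 * (|z₀ i| + R + 1) ≤ ((F.P K).sitesPerDir (k + 1) : ℤ))
    {c : PBond (F.P K) (k + 1)} (hsrc : c.src ∈ recordWindow F k K R z₀) (htgt : c.tgt ∈ recordWindow F k K R z₀) (A' : VecField (F.P (K + 1)) 0 V) :
    bondAvgIter (k + 1) A' (liftBondCtr F K (k + 1) c) = bondAvgIter (k + 1) (fun b => A' (liftBondCtr F K 0 b)) c := by
  classical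
  have hkK : k + 1 ≤ (F.P K).m + (F.P K).K := by simpa using hk
  have hkK' : k + 1 ≤ (F.P (K + 1)).m + (F.P (K + 1)).K := by simp only [T4Family.P_m, T4Family.P_K]; omega
  set M : ℤ := (F.L : ℤ) ^ (k + 1) with hM
  have hM0 : 0 < M := by have := (F.P K).L_pos; positivity
  have hN0 : ((F.P K).sitesPerDir 0 : ℤ) = M * (F.P K).sitesPerDir (k + 1) := sitesPerDir_zero_eq_pow_mul F K (k + 1) hk
  rw [B5Eq118OneStroke.bondAvgIter_eq_blockSum (k + 1) hkK', B5Eq118OneStroke.bondAvgIter_eq_blockSum (k + 1) hkK]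
  show ((((((F.P (K + 1)).L : ℝ) ^ ((F.P (K + 1)).d + 1)) ^ (k + 1))⁻¹) • ∑ x ∈ iterBlock (k + 1) (liftSiteCtr F K (k + 1) c.src), segSum A' x c.dir ((F.P (K + 1)).L ^ (k + 1))) = _
  rw [← image_liftSiteCtr_iterBlock F k K R hk z₀ hc hsrc, Finset.sum_image fun a _ a' _ h => liftSiteCtr_injective F K 0 (Nat.zero_le _) h]
  simp only [T4Family.P_L, T4Family.P_d]
  congr 1
  refine Finset.sum_congr rfl fun x hx => ?_
  -- the straight contour from `x ∈ B^{k+1}(c₋)`: every run site lies over the block `c₋` or `c₊`, hence is centred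
  rw [B5Eq118OneStroke.mem_iterBlock] at hx
  simp only [LatticeFieldCalculus.segSum, LatticeFieldCalculus.runBond]
  refine Finset.sum_congr rfl fun t ht => ?_
  rw [Finset.mem_range] at ht
  -- integer coordinates
  set z : Fin 4 → ℤ := fun i => ((x (Fin.cast (F.P_d K).symm i)).valMinAbs : ℤ) with hzdef
  have hxz : siteOfInt F K 0 z = x := siteOfInt_valMinAbs F K 0 x
  set cs : Fin 4 → ℤ := fun i => ((c.src (Fin.cast (F.P_d K).symm i)).valMinAbs : ℤ) with hcsdef
  have hcsy : siteOfInt F K (k + 1) cs = c.src := siteOfInt_valMinAbs F K (k + 1) c.src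
  have hc' : ∀ i, 2 * (|z₀ i| + R) < ((F.P K).sitesPerDir (k + 1) : ℤ) := fun i => by linarith [hc i]
  have hcsR : ∀ i, |cs i - z₀ i| ≤ R := by
    rw [← hcsy, mem_recordWindow_siteOfInt_iff F k K R z₀ cs hc' fun i => two_mul_abs_valMinAbs_le F K (k + 1) c.src _] at hsrc; exact hsrc
  have hcsb : ∀ i, 2 * (|cs i| + 1) ≤ ((F.P K).sitesPerDir (k + 1) : ℤ) := fun i => by
    have : |cs i| ≤ |z₀ i| + R := by
      calc |cs i| = |(cs i - z₀ i) + z₀ i| := by ring_nf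
        _ ≤ |cs i - z₀ i| + |z₀ i| := abs_add_le _ _
        _ ≤ |z₀ i| + R := by linarith [hcsR i]
    linarith [hc i]
  -- `c₊ = Φ (cs + e_dir)` also lies in the cube
  have htgt' : siteOfInt F K (k + 1) (cs + Pi.single (Fin.cast (F.P_d K) c.dir) 1) ∈ recordWindow F k K R z₀ := by
    rw [siteOfInt_add_single, hcsy]; exact htgt
  have hcs2 : ∀ i, 2 * |(cs + Pi.single (Fin.cast (F.P_d K) c.dir) (1 : ℤ) : Fin 4 → ℤ) i| ≤ ((F.P K).sitesPerDir (k + 1) : ℤ) := fun i => by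
    rw [Pi.add_apply]
    have h1 : |cs i + (Pi.single (Fin.cast (F.P_d K) c.dir) (1 : ℤ) : Fin 4 → ℤ) i| ≤ |cs i| + 1 := by
      refine (abs_add_le _ _).trans ?_
      by_cases h : i = Fin.cast (F.P_d K) c.dir
      · subst h; rw [Pi.single_eq_same]; simp
      · rw [Pi.single_eq_of_ne h]; simp
    linarith [hcsb i]
  have htgtR : ∀ i, |(cs + Pi.single (Fin.cast (F.P_d K) c.dir) (1 : ℤ) : Fin 4 → ℤ) i - z₀ i| ≤ R := by
    rw [mem_recordWindow_siteOfInt_iff F k K R z₀ _ hc' hcs2] at htgt'; exact htgt'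
  have hcsb' : 2 * (|cs (Fin.cast (F.P_d K) c.dir) + 1| + 1) ≤ ((F.P K).sitesPerDir (k + 1) : ℤ) := by
    have h := htgtR (Fin.cast (F.P_d K) c.dir)
    rw [Pi.add_apply, Pi.single_eq_same] at h
    have : |cs (Fin.cast (F.P_d K) c.dir) + 1| ≤ |z₀ (Fin.cast (F.P_d K) c.dir)| + R := by
      calc |cs (Fin.cast (F.P_d K) c.dir) + 1| = |(cs (Fin.cast (F.P_d K) c.dir) + 1 - z₀ (Fin.cast (F.P_d K) c.dir)) + z₀ (Fin.cast (F.P_d K) c.dir)| := by ring_nf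
        _ ≤ |cs (Fin.cast (F.P_d K) c.dir) + 1 - z₀ (Fin.cast (F.P_d K) c.dir)| + |z₀ (Fin.cast (F.P_d K) c.dir)| := abs_add_le _ _
        _ ≤ |z₀ (Fin.cast (F.P_d K) c.dir)| + R := by linarith
    linarith [hc (Fin.cast (F.P_d K) c.dir)]
  -- `z ∕ M = cs`
  have hzM : (fun i => z i / M) = cs := by
    refine siteOfInt_inj_of_abs_sub_lt F K (k + 1) ?_ fun i => ?_
    · rw [← iterBlockOf_siteOfInt F K (k + 1) hkK z, hxz, hx, hcsy]
    · have h1 : 2 * |z i / M| ≤ ((F.P K).sitesPerDir (k + 1) : ℤ) := two_mul_abs_ediv_pow_le F K (k + 1) hk (two_mul_abs_valMinAbs_le F K 0 x _)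
      have := abs_sub (z i / M) (cs i); linarith [hcsb i]
  have hzc : ∀ i, z i * 2 ∈ Set.Ioc (-((F.P K).sitesPerDir 0 : ℤ)) ((F.P K).sitesPerDir 0) := fun i =>
    mem_Ioc_of_two_mul_abs_lt (two_mul_abs_lt_of_ediv_eq' F K k hk (congrFun hzM i) (hcsb i))
  -- the run label `z + t e_dir` is centred: over block `cs` or `cs + 1` in the direction `dir`, over `cs` elsewhere
  have hzt : ∀ i, (z + Pi.single (Fin.cast (F.P_d K) c.dir) (t : ℤ) : Fin 4 → ℤ) i * 2 ∈ Set.Ioc (-((F.P K).sitesPerDir 0 : ℤ)) ((F.P K).sitesPerDir 0) := by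
    intro i
    rw [Pi.add_apply]
    by_cases h : i = Fin.cast (F.P_d K) c.dir
    · subst h
      rw [Pi.single_eq_same]
      apply mem_Ioc_of_two_mul_abs_lt
      have hzi : z (Fin.cast (F.P_d K) c.dir) / M = cs (Fin.cast (F.P_d K) c.dir) := congrFun hzM (Fin.cast (F.P_d K) c.dir)
      have hb1 : cs (Fin.cast (F.P_d K) c.dir) * M ≤ z (Fin.cast (F.P_d K) c.dir) := by rw [← hzi]; exact Int.ediv_mul_le _ hM0.ne'
      have hb2 : z (Fin.cast (F.P_d K) c.dir) < cs (Fin.cast (F.P_d K) c.dir) * M + M := by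
        have := Int.lt_ediv_add_one_mul_self (z (Fin.cast (F.P_d K) c.dir)) hM0; rw [hzi] at this; linarith
      have ht' : (t : ℤ) < M := by rw [hM]; exact_mod_cast ht
      exact two_mul_abs_lt_of_run hM0 hN0 (hcsb _) hcsb' (by linarith) (by linarith)
    · rw [Pi.single_eq_of_ne h, add_zero]; exact hzc i
  rw [← hxz]
  show _ = A' ⟨liftSiteCtr F K 0 (runSite (siteOfInt F K 0 z) c.dir t), c.dir⟩
  rw [liftSiteCtr_runSite_of F K 0 z c.dir t hzc hzt]

end Averages

end Summit.QuantumFields.YangMills.Theorems.PortU8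

end
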